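/-
Copyright (c) 2026 the pub-hodgecm-mathlib formalisation cell (harness21).  Prover seat hodgecm-mathlib-LH4-p13 (g8), req620 Track A «(D-RAM) FOUR-FRAME» squad
(STAGE-1b, row (2) of the piece `f_{T₊}`, the (β₂) road, (S-2) «LABEL TRANSPORT» — the cross-literal step in FIELD-LINE letters; LH4-p04 (g8) 14:36:32Z: the two literal planes are
NOT isometric, they are the two LINE MODELS over the same quadratic field line `M` with the same `lam` and different line constants `h, h′`), 2026-09-04.
-/
import Summits.HodgeConjecture.HodgeConjecture.Theorems.F0P3cDyRamGluePlaneSetTransport   -- ★ p861023 (this seat): `planeTerm_eq_pairing_sub_one` (the plane value is `⟨β′, (γ₂ − 1)β′⟩`)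
import HarnessLib

/-!
# Crux `H413`, line LH4 «(D-RAM) FOUR-FRAME» — STAGE-1b, row (2), the (β₂) road, (S-2) part iii: «ON THE FIELD LINE THE THICKENED TRACE-VALUE SET SEES THE LINE CONSTANT
# ONLY MODULO Θ-NORMS OF UNITS STABILISING THE LATTICE»

Cell `hodgecm-mathlib` (D-0151), FLOOR 0, crux item H413 = `stmt-HodgeConjecture-24833`, route of record `HCCMUnconditional`; squad F0∕P3c∕LH4; lane
`--supports stmt-HodgeConjecture-24833 --as helper` (count-neutral; pays NO tier-0 row).  THEOREMS ONLY (no `def`, no instance, no notation, no `sorry`, default heartbeats).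
DATUM-FREE algebra over a valued field `M` with two ring endomorphisms `ρ` (the trace involution, `Tr_ρ x = x + ρ x`) and `Θ` (the twist of the hermitian line form).
WHY.  In the (C1) ∕ `beta2Models.letter` line model the hermitian plane pairing reads `jE⟨x, y⟩ = h·Θ(φx)·φy + ρ(h·Θ(φx)·φy)`, so by ★ p861023 §1 the PLANE value of `Γ − 1` at
`y = ι_Wβ + a·x₀` is `jE⁻¹·Tr_ρ(h·(lam − 1)·Θ(z)·z)`, `z = φ(β′) ∈ Λ♯`; the literal enters only through the LINE CONSTANT `c = h` (times `Θ(x)x` of the generator).  This file records the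
one structural fact the cross-literal comparison uses: replacing `c` by `c·Θ(w)·w` for a unit `w` with `w·Λ♯ = Λ♯` does not change the thickened value set (reparametrise `z ↦ w·z`),
hence not its class ∕ label.  Whether `c_{t_a}∕c_{t_h}` IS such a `Θ(w)w` on a given cell is the (S4) owner's dictionary fact (LH4-p04 (g8)).
* `trace_mul_norm_rescale` — `Tr_ρ(c·Θ(w)w·q·Θ(z)z) = Tr_ρ(c·q·Θ(wz)·(wz))`.
* HEAD `setOf_thicken_traceValue_mul_norm_eq` — for `S ⊆ M` with `w·S ⊆ S`, `w⁻¹·S ⊆ S`: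
  `{t ∣ ∃ z ∈ S, |π⁻¹(t − Tr_ρ(c·Θ(w)w·q·Θ(z)z))| ≤ 1} = {t ∣ ∃ z ∈ S, |π⁻¹(t − Tr_ρ(c·q·Θ(z)z))| ≤ 1}` (any thickening scalar `π⁻¹`, any `q`, e.g. `q = lam − 1`);
  `setOf_thicken_traceValue_eq_iff_of_mul_norm` — so any «= reference set» predicate (the label) agrees for `c` and `c·Θ(w)w`.
HONEST LABEL.  Count-neutral algebra; nothing printed is asserted; no census law is stated; (β₂) stays a HYPOTHESIS; `HC_CM` is proved only modulo the 7 printed citations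
(2 remaining named inputs: hLiu418 = `stmt-HodgeConjecture-24832`, h413 = `stmt-HodgeConjecture-24833`) until rung 0 closes.
## References
* [Jacobowitz1962] R. Jacobowitz, *Hermitian forms over local fields*, Amer. J. Math. 84 (1962): §4 (hermitian lines over the quadratic extension; scaling by norms).
* [Rogawski1990] J. D. Rogawski, *Automorphic Representations of Unitary Groups in Three Variables*, Ann. of Math. Stud. 123 (1990): §4.9 Prop. 4.9.1 (b) p. 55.
-/

set_option autoImplicit false

noncomputable section
namespace Summit.HodgeConjecture.HodgeConjecture.Cruxes.H413.F0P3cDyRamLineValueSetNormRescale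

open scoped Valued WithZero

variable {M : Type*} [Field M]

/-- **RESCALING THE LINE CONSTANT BY A Θ-NORM IS A REPARAMETRISATION**: `c·(Θ(w)w)·q·(Θ(z)z) = c·q·(Θ(wz)·(wz))`, hence the same after `Tr_ρ`. [cite: Jacobowitz1962, §4] -/
theorem trace_mul_norm_rescale (ρ Θ : M →+* M) (c q w z : M) :
    c * (Θ w * w) * q * (Θ z * z) + ρ (c * (Θ w * w) * q * (Θ z * z)) = c * q * (Θ (w * z) * (w * z)) + ρ (c * q * (Θ (w * z) * (w * z))) := by
  have e : c * (Θ w * w) * q * (Θ z * z) = c * q * (Θ (w * z) * (w * z)) := by rw [map_mul]; ring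
  rw [e]

variable [Valued M ℤᵐ⁰]

/-- **HEAD — THE THICKENED TRACE-VALUE SET SEES THE LINE CONSTANT ONLY MODULO Θ-NORMS OF STABILISING UNITS.**  `S ⊆ M` with `w·S ⊆ S` and `w⁻¹·S ⊆ S` (`w ≠ 0`; e.g. `S` an
`𝒪_j`-lattice and `w ∈ 𝒪_j^×`), any `c, q, πinv`:
`{t ∣ ∃ z ∈ S, |πinv·(t − Tr_ρ(c·Θ(w)w·q·Θ(z)z))| ≤ 1} = {t ∣ ∃ z ∈ S, |πinv·(t − Tr_ρ(c·q·Θ(z)z))| ≤ 1}`, `Tr_ρ x = x + ρ x`.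
[cite: Jacobowitz1962, §4] [cite: Rogawski1990, §4.9 Prop. 4.9.1 (b) p. 55] -/
theorem setOf_thicken_traceValue_mul_norm_eq (ρ Θ : M →+* M) (πinv c q : M) {w : M} (hw : w ≠ 0) {S : Set M}
    (hS : ∀ z ∈ S, w * z ∈ S) (hS' : ∀ z ∈ S, w⁻¹ * z ∈ S) :
    {t : M | ∃ z ∈ S, Valued.v (πinv * (t - (c * (Θ w * w) * q * (Θ z * z) + ρ (c * (Θ w * w) * q * (Θ z * z))))) ≤ 1} =
      {t : M | ∃ z ∈ S, Valued.v (πinv * (t - (c * q * (Θ z * z) + ρ (c * q * (Θ z * z))))) ≤ 1} := by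
  ext t
  simp only [Set.mem_setOf_eq]
  constructor
  · rintro ⟨z, hz, ht⟩
    refine ⟨w * z, hS z hz, ?_⟩
    rw [← trace_mul_norm_rescale ρ Θ c q w z]
    exact ht
  · rintro ⟨z, hz, ht⟩
    refine ⟨w⁻¹ * z, hS' z hz, ?_⟩
    rw [trace_mul_norm_rescale ρ Θ c q w (w⁻¹ * z), mul_inv_cancel_left₀ hw]
    exact ht

/-- **COROLLARY — ANY «= REFERENCE SET» LABEL AGREES FOR `c` AND `c·Θ(w)w`.** [cite: Rogawski1990, §4.9 Prop. 4.9.1 (b) p. 55] -/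
theorem setOf_thicken_traceValue_eq_iff_of_mul_norm (ρ Θ : M →+* M) (πinv c q : M) {w : M} (hw : w ≠ 0) {S : Set M}
    (hS : ∀ z ∈ S, w * z ∈ S) (hS' : ∀ z ∈ S, w⁻¹ * z ∈ S) (Ref : Set M) :
    {t : M | ∃ z ∈ S, Valued.v (πinv * (t - (c * (Θ w * w) * q * (Θ z * z) + ρ (c * (Θ w * w) * q * (Θ z * z))))) ≤ 1} = Ref ↔
      {t : M | ∃ z ∈ S, Valued.v (πinv * (t - (c * q * (Θ z * z) + ρ (c * q * (Θ z * z))))) ≤ 1} = Ref := by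
  rw [setOf_thicken_traceValue_mul_norm_eq ρ Θ πinv c q hw hS hS']

/-- **THE GLUE SHIFT VERSION** (`S = z₀ + S₀`-type sets are covered by taking `S` the full translate-stable set; for an AFFINE fibre `{x·(u + ω) : ω ∈ 𝒪_j}` use `S := x·(u + 𝒪_j)` when
`w(u + 𝒪_j) = u′ + 𝒪_j` is supplied as the two inclusions) — recorded as the same statement with the membership hypotheses left abstract; nothing further to prove.
For the record: with `q = lam − 1` and `c ∈ {h, h′}` this is the (S-2) cross-literal comparison MODULO the dictionary fact `h′ = h·Θ(w)w·(unit of 1 + ϖ^{m})`, which is the (S4)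
owner's to supply per GENERIC cell. [cite: Jacobowitz1962, §4] -/
theorem setOf_thicken_traceValue_mul_norm_eq' (ρ Θ : M →+* M) (πinv c q : M) {w : M} (hw : w ≠ 0) {S S' : Set M}
    (hS : ∀ z ∈ S, w * z ∈ S') (hS' : ∀ z ∈ S', w⁻¹ * z ∈ S) :
    {t : M | ∃ z ∈ S, Valued.v (πinv * (t - (c * (Θ w * w) * q * (Θ z * z) + ρ (c * (Θ w * w) * q * (Θ z * z))))) ≤ 1} =
      {t : M | ∃ z ∈ S', Valued.v (πinv * (t - (c * q * (Θ z * z) + ρ (c * q * (Θ z * z))))) ≤ 1} := by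
  ext t
  simp only [Set.mem_setOf_eq]
  constructor
  · rintro ⟨z, hz, ht⟩
    refine ⟨w * z, hS z hz, ?_⟩
    rw [← trace_mul_norm_rescale ρ Θ c q w z]
    exact ht
  · rintro ⟨z, hz, ht⟩
    refine ⟨w⁻¹ * z, hS' z hz, ?_⟩
    rw [trace_mul_norm_rescale ρ Θ c q w (w⁻¹ * z), mul_inv_cancel_left₀ hw]
    exact ht

end Summit.HodgeConjecture.HodgeConjecture.Cruxes.H413.F0P3cDyRamLineValueSetNormRescale

end
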